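import Summits.Ventures.QEC.Census.BZAutPerm
import Summits.Ventures.QEC.Census.RankCert
import HarnessLib

/-!
# `X ↔ Z` exchanging permutations checked in the kernel: `d_X = d_Z` for ONE-SIDED distance certificates,
# and the one-sided `[[n,k,d]]` assembly (plan/CERT-FORMAT.md v1.3 (d), lower-section method `lemma_XZ`)

Kernel A (qec-search-1, CERT-FORMAT v1.3 (d)) and kernel B (qec-search-2, R11 (i)) certify two-block codes ONE-SIDED:
the `Z` side's lower bound is enumerated (`bz` / `bz_aut` / `mitm` / `sat_lrat`), the `X` side carries only its upper
witness and the tag `assumes = LemmaXZ` — "`d_X = d_Z` by `Literature.…BB.Code.dX_eq_dZ` (p459385) /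
`AbelianTwoBlock.css_dX_eq_dZ` (p464551)".  Those lemmas speak about TYPED code objects (`BB.Code ℓ m`,
`AbelianTwoBlock.css a b`); using them on a census row needs a typed object and a kernel index identity per row (as the
five BB routes did).  The 47 one-sided `lemma_XZ` certificates of qec-search-8's A.3/A.4/A.5w rows (generalized-bicycle
codes over `ℤ_N`, abelian two-block codes over `ℤ_{m₁} × ⋯ × ℤ_{m_r}`) have no typed object.  This file discharges the
tag IN THE KERNEL ON THE CERTIFICATE'S OWN MATRICES, family-agnostically, next to qec-type-12's explicit-permutation
`bz_aut` transport (`Census/BZAutPerm.lean`, whose permutation tables `permListOK` / `permFun` / `permEquiv` and word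
transport `permWord` it reuses):

* `crossMapOK n H H' perm rows` — row transport BETWEEN two row lists: the word of row `i` of `H` transported by the
  permutation IS row `rows[i]` of `H'`; soundness `exists_submatrix_eq_of_crossMapOK :
  ∃ ρ, (rowMatrix n H').submatrix ρ (permEquiv n perm) = rowMatrix n H` (type-12's `rowMapOK` is the case `H' = H`);
* `XZSwap` / `xzSwapOK n HX HZ sw` — ONE permutation of the qubits mapping every `H^X` row onto a stated `H^Z` row
  (`rowsXZ`) and every `H^Z` row onto a stated `H^X` row (`rowsZX`).  For an abelian two-block code
  `H^X = [A|B]`, `H^Z = [Bᵀ|Aᵀ]` over a group `G` the emitter ships `(L,g) ↦ (R,−g)`, `(R,g) ↦ (L,−g)` with both row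
  maps `g ↦ −g` (Bravyi–Cross–Gambetta–Maslov–Rall–Yoder 2024, proof of Lemma 1: `H^Z = C H^X [[0,C],[C,0]]`;
  `Literature/…/AbelianTwoBlockCodes.HZ_eq_submatrix`, qec-lit-3) — but ANY listed permutation is simply CHECKED, its
  provenance is irrelevant;
* SOUNDNESS `dZ_eq_dX_of_cross` (for an arbitrary `CSSCode` and row MAPS, not necessarily bijections): the transport
  `v ↦ v ∘ σ⁻¹` carries `rs H^X` into `rs H^Z` and `rs H^Z` into `rs H^X`, hence — a linear injection and a
  dimension count (`map_rowSpace_eq_of_cross`) — exactly ONTO; it preserves the dot product, so it exchanges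
  `ker H^X` with `ker H^Z` (`mulVec_eq_zero_iff_of_cross`, kernels = orthogonals of row spaces) and `rs H^Z` with
  `rs H^X` (`mem_rowSpace_iff_of_cross`); being weight-preserving it is a bijection between the non-trivial `Z`- and
  `X`-logicals, so `d_Z = d_X` including the junk value `0` (the bijective-row-map special case is type-05's
  `CSSEquivalence.dX_eq_of_submatrix` applied to `C.swap`);
* the `DistCert` wrappers **`DistCert.dX_eq_dZ_of_xzSwapOK`**, `dX_code_of_xzSwapOK` (the `X` side from a certified
  `Z` side when the certificate states `dX = dZ`) and **`DistCert.isCode_of_onesided`**: `Z` side certified by ANY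
  lane (`(c.code _).dZ = c.dZ`) + `xzSwapOK` + the two rank certificates (type-02 `RankCert`) ⇒
  `(c.code _).IsCode n (n − rX − rZ) dZ` — the census row's CLAIM discharged with no typed object;
  `isCode_of_onesided_lower`: the same from `checkStructure` + a flat `Z` lower bound `dZ − 1 < |w|` (the conclusion
  shape of every lane's lower-bound theorem) — the one-line row closer;
* controls by `decide`: `[[4,2,2]]` and Steane end to end (`isCode_certSteane7_onesided : IsCode 7 1 3` from the
  `Z` side of the brute-force certificate + the identity swap), Shor `[[9,1,3]]` REJECTED (not `X ↔ Z` symmetric),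
  a `ℤ₃` two-block toy accepted.
Tier KERNEL, axioms standard, no `native_decide`; no certificate of a census row is read here.
-/

namespace Summit.Ventures.QEC.Census

open Matrix Literature.InformationTheory.QuantumCodes

/-! ## The checks (structural `List`/`Nat` recursion, `decide`) -/

/-- Row transport BETWEEN two row lists (rows as words over `n` qubits): for every row `i` of `H`, `rows[i]` is a row
index of `H'` and the word `H'[rows[i]]` equals row `i` of `H` transported by the permutation table `perm`
(`permWord (permFun perm) H[i] n`, bit `q ↦ perm[q]`). With `H' = H` this is qec-type-12's `rowMapOK`. (definition) -/
def crossMapOK (n : ℕ) (H H' : List ℕ) (perm rows : List ℕ) : Bool :=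
  (List.range H.length).all fun i =>
    decide (rows.getD i 0 < H'.length) && (H'.getD (rows.getD i 0) 0 == permWord (permFun perm) (H.getD i 0) n)

/-- An `X ↔ Z` exchanging permutation of a CSS code given by row words (the data an emitter ships for a one-sided
certificate): `perm[q]` = image of qubit `q`; `rowsXZ[i]` = index of the `H^Z` row that is the image of `H^X` row `i`;
`rowsZX[j]` = index of the `H^X` row that is the image of `H^Z` row `j`. -/
structure XZSwap where
  /-- permutation table: bit `q ↦ perm[q]` -/
  perm : List ℕ
  /-- image row index (in `H^Z`) of every `H^X` row -/
  rowsXZ : List ℕ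
  /-- image row index (in `H^X`) of every `H^Z` row -/
  rowsZX : List ℕ

/-- **The `X ↔ Z` swap check**: `perm` tabulates a permutation of the `n` qubits (type-12's `permListOK`), it maps every
`H^X` row onto the stated `H^Z` row and every `H^Z` row onto the stated `H^X` row. (definition, `decide`) -/
def xzSwapOK (n : ℕ) (HX HZ : List ℕ) (sw : XZSwap) : Bool :=
  permListOK n sw.perm && crossMapOK n HX HZ sw.perm sw.rowsXZ && crossMapOK n HZ HX sw.perm sw.rowsZX

namespace DistCert

/-- The `X ↔ Z` swap check against a certificate's own matrices. (definition) -/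
def xzSwapOK (c : DistCert) (sw : XZSwap) : Bool := Census.xzSwapOK c.n c.HX c.HZ sw

end DistCert

/-! ## Soundness, I: the check gives cross row maps along the tabulated permutation -/

/-- **Soundness of `crossMapOK`**: the tabulated permutation `σ = permEquiv n perm` carries row `i` of
`rowMatrix n H` to row `rows[i]` of `rowMatrix n H'`: `(rowMatrix n H').submatrix ρ σ = rowMatrix n H` for the
listed row map `ρ = rows`. -/
theorem exists_submatrix_eq_of_crossMapOK {n : ℕ} {H H' perm rows : List ℕ} (hperm : permListOK n perm = true)
    (h : crossMapOK n H H' perm rows = true) :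
    ∃ ρ : Fin H.length → Fin H'.length, (rowMatrix n H').submatrix ρ (permEquiv n perm) = rowMatrix n H := by
  simp only [crossMapOK, List.all_eq_true, List.mem_range, Bool.and_eq_true, decide_eq_true_eq, beq_iff_eq] at h
  refine ⟨fun i => ⟨rows.getD i 0, (h i i.2).1⟩, ?_⟩
  ext i j
  obtain ⟨hlt, hrow⟩ := h i i.2
  have e1 : H'.getD (rows.getD i 0) 0 = H'[rows.getD i 0] := by
    rw [List.getD_eq_getElem?_getD, List.getElem?_eq_getElem hlt, Option.getD_some]
  have e2 : H.getD i 0 = H[(i : ℕ)] := by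
    rw [List.getD_eq_getElem?_getD, List.getElem?_eq_getElem i.2, Option.getD_some]
  rw [e1, e2] at hrow
  simp only [submatrix_apply, rowMatrix]
  change ofBits n H'[rows.getD (i : ℕ) 0] (permEquiv n perm j) = ofBits n H[(i : ℕ)] j
  rw [hrow, ofBits_permWord_permFun hperm]
  simp

/-! ## Soundness, II: a permutation exchanging the two row sets exchanges `Z`-logicals and `X`-logicals -/

section SwapSound

variable {ι rA rB : Type*} {A : Matrix rA ι (ZMod 2)} {B : Matrix rB ι (ZMod 2)} {σ : ι ≃ ι}

/-- The coordinate transport `v ↦ v ∘ σ⁻¹` as a linear automorphism of `𝔽₂^ι`. (definition, reducible) -/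
abbrev transportEquiv (σ : ι ≃ ι) : (ι → ZMod 2) ≃ₗ[ZMod 2] (ι → ZMod 2) :=
  LinearEquiv.funCongrLeft (ZMod 2) (ZMod 2) σ.symm

/-- The transport acts as `v ↦ v ∘ σ⁻¹`. -/
theorem transportEquiv_apply (σ : ι ≃ ι) (v : ι → ZMod 2) : transportEquiv σ v = v ∘ σ.symm := rfl

/-- A cross row map sends one row space INTO the other (every row goes to a row). -/
theorem map_rowSpace_le_of_cross [Fintype rA] [Fintype rB] {ρ : rA → rB} (h : B.submatrix ρ σ = A) :
    Submodule.map (transportEquiv σ : (ι → ZMod 2) →ₗ[ZMod 2] (ι → ZMod 2)) (rowSpace A) ≤ rowSpace B := by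
  have hA : rowSpace A = Submodule.span (ZMod 2) (Set.range A.row) := range_vecMulLinear A
  have hB : rowSpace B = Submodule.span (ZMod 2) (Set.range B.row) := range_vecMulLinear B
  rw [hA, hB, Submodule.map_span]
  refine Submodule.span_mono ?_
  rintro _ ⟨_, ⟨i, rfl⟩, rfl⟩
  refine ⟨ρ i, ?_⟩
  change B.row (ρ i) = A.row i ∘ σ.symm
  funext j
  change B (ρ i) j = A i (σ.symm j)
  rw [← h]
  simp

/-- **Cross row maps in both directions exchange the row spaces exactly**: each row space is carried injectively into
the other, so the dimensions agree and the inclusion is an equality. -/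
theorem map_rowSpace_eq_of_cross [Fintype ι] [Fintype rA] [Fintype rB] {ρ₁ : rA → rB} {ρ₂ : rB → rA}
    (h₁ : B.submatrix ρ₁ σ = A) (h₂ : A.submatrix ρ₂ σ = B) :
    Submodule.map (transportEquiv σ : (ι → ZMod 2) →ₗ[ZMod 2] (ι → ZMod 2)) (rowSpace A) = rowSpace B := by
  have hle₁ := map_rowSpace_le_of_cross h₁
  have hle₂ := map_rowSpace_le_of_cross h₂
  have hd₁ := Submodule.finrank_mono hle₁
  have hd₂ := Submodule.finrank_mono hle₂
  rw [LinearEquiv.finrank_map_eq] at hd₁ hd₂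
  exact Submodule.eq_of_le_of_finrank_eq hle₁ (by rw [LinearEquiv.finrank_map_eq]; omega)

/-- The kernel of a check matrix is the orthogonal of its row space for the standard dot product. -/
theorem mulVec_eq_zero_iff_forall_rowSpace [Fintype ι] [Fintype rA] (A : Matrix rA ι (ZMod 2)) (v : ι → ZMod 2) :
    A *ᵥ v = 0 ↔ ∀ u ∈ rowSpace A, u ⬝ᵥ v = 0 := by
  classical
  constructor
  · intro hv u hu
    rw [dotProduct_comm]
    exact dotProduct_eq_zero_of_mem_rowSpace hu hv
  · intro h
    funext i
    have hi : A.row i ∈ rowSpace A := mem_rowSpace_of_vecMul_eq (Pi.single i 1) (Matrix.single_one_vecMul i A)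
    exact h (A i) hi

/-- **Kernels are exchanged**: `A v = 0 ↔ B (v ∘ σ⁻¹) = 0` (the transport preserves dot products). -/
theorem mulVec_eq_zero_iff_of_cross [Fintype ι] [Fintype rA] [Fintype rB] {ρ₁ : rA → rB} {ρ₂ : rB → rA}
    (h₁ : B.submatrix ρ₁ σ = A) (h₂ : A.submatrix ρ₂ σ = B) (v : ι → ZMod 2) :
    A *ᵥ v = 0 ↔ B *ᵥ (v ∘ σ.symm) = 0 := by
  have hmap := map_rowSpace_eq_of_cross h₁ h₂
  rw [mulVec_eq_zero_iff_forall_rowSpace, mulVec_eq_zero_iff_forall_rowSpace]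
  constructor
  · intro h u hu
    rw [← hmap] at hu
    obtain ⟨u₀, hu₀, rfl⟩ := hu
    change (u₀ ∘ σ.symm) ⬝ᵥ (v ∘ σ.symm) = 0
    rw [comp_equiv_dotProduct_comp_equiv]
    exact h u₀ hu₀
  · intro h u hu
    have hu' : u ∘ σ.symm ∈ rowSpace B := by
      rw [← hmap]
      exact ⟨u, hu, rfl⟩
    have := h _ hu'
    rwa [comp_equiv_dotProduct_comp_equiv] at this

/-- **Row spaces are exchanged**: `v ∈ rs B ↔ v ∘ σ⁻¹ ∈ rs A`. -/
theorem mem_rowSpace_iff_of_cross [Fintype ι] [Fintype rA] [Fintype rB] {ρ₁ : rA → rB} {ρ₂ : rB → rA}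
    (h₁ : B.submatrix ρ₁ σ = A) (h₂ : A.submatrix ρ₂ σ = B) (v : ι → ZMod 2) :
    v ∈ rowSpace B ↔ v ∘ σ.symm ∈ rowSpace A := by
  have hmap := map_rowSpace_eq_of_cross h₂ h₁
  constructor
  · intro hv
    rw [← hmap]
    exact ⟨v, hv, rfl⟩
  · intro hv
    rw [← hmap] at hv
    obtain ⟨v₀, hv₀, he⟩ := hv
    have : v₀ = v := (transportEquiv σ).injective he
    rwa [← this]

/-- **`d_Z = d_X` from an `X ↔ Z` exchanging permutation** of an arbitrary CSS code: `v ↦ v ∘ σ⁻¹` is a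
weight-preserving bijection between `ker H^X ∖ rs H^Z` and `ker H^Z ∖ rs H^X`, so the two minima coincide (junk value
`0` included: both sets are empty together). Row maps are arbitrary functions (what a checker verifies); the
bijective case is `CSSEquivalence.dX_eq_of_submatrix` for `C.swap`. -/
theorem dZ_eq_dX_of_cross [Fintype ι] [DecidableEq ι] [Fintype rA] [Fintype rB] (C : CSSCode rA rB ι)
    {ρ₁ : rA → rB} {ρ₂ : rB → rA} (h₁ : C.HZ.submatrix ρ₁ σ = C.HX) (h₂ : C.HX.submatrix ρ₂ σ = C.HZ) :
    C.dZ = C.dX := by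
  rw [CSSCode.dZ_eq, CSSCode.dX]
  congr 1
  ext w
  constructor
  · rintro ⟨v, ⟨hv, hv'⟩, rfl⟩
    refine ⟨v ∘ σ.symm, ⟨?_, ?_⟩, hammingNorm_comp_equiv v σ⟩
    · exact (mulVec_eq_zero_iff_of_cross h₁ h₂ v).1 hv
    · exact fun h => hv' ((mem_rowSpace_iff_of_cross h₁ h₂ v).2 h)
  · rintro ⟨x, ⟨hx, hx'⟩, rfl⟩
    have hxs : (x ∘ σ) ∘ σ.symm = x := funext fun j => by simp
    refine ⟨x ∘ σ, ⟨?_, ?_⟩, ?_⟩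
    · change C.HX *ᵥ (x ∘ σ) = 0
      rw [mulVec_eq_zero_iff_of_cross h₁ h₂, hxs]
      exact hx
    · intro h
      apply hx'
      have := (mem_rowSpace_iff_of_cross h₁ h₂ (x ∘ σ)).1 h
      rwa [hxs] at this
    · have := hammingNorm_comp_equiv (x ∘ σ) σ
      rw [hxs] at this
      exact this.symm

end SwapSound

/-! ## Soundness, III: the `DistCert` wrappers — one-sided certificates -/

namespace DistCert

variable (c : DistCert) {sw : XZSwap}

/-- **Soundness of `xzSwapOK`**: a checked `X ↔ Z` exchanging permutation gives `d_X = d_Z` for the certificate's own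
code — CERT-FORMAT v1.3 (d)'s `assumes = LemmaXZ` DISCHARGED in the kernel with no typed code object. -/
theorem dX_eq_dZ_of_xzSwapOK (hc : commOK c.n c.HX c.HZ = true) (h : c.xzSwapOK sw = true) :
    (c.code hc).dX = (c.code hc).dZ := by
  simp only [xzSwapOK, Census.xzSwapOK, Bool.and_eq_true] at h
  obtain ⟨⟨hp, hXZ⟩, hZX⟩ := h
  obtain ⟨ρ₁, hρ₁⟩ := exists_submatrix_eq_of_crossMapOK hp hXZ
  obtain ⟨ρ₂, hρ₂⟩ := exists_submatrix_eq_of_crossMapOK hp hZX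
  exact (dZ_eq_dX_of_cross (c.code hc) (ρ₁ := ρ₁) (ρ₂ := ρ₂) hρ₁ hρ₂).symm

/-- **The `X` side from the `Z` side**: if the `Z` side is certified (`(c.code _).dZ = c.dZ`, by any lane), the
certificate states `dX = dZ`, and the swap checks, then `(c.code _).dX = c.dX`. -/
theorem dX_code_of_xzSwapOK (hc : commOK c.n c.HX c.HZ = true) (h : c.xzSwapOK sw = true) (hd : c.dX = c.dZ)
    (hZ : (c.code hc).dZ = c.dZ) : (c.code hc).dX = c.dX := by
  rw [c.dX_eq_dZ_of_xzSwapOK hc h, hZ, hd]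

/-- **The CLAIM discharged from a one-sided certificate**: the `Z` side certified by any lane, the swap checked, and
the two rank certificates (type-02 `RankCert`, CERT-FORMAT `k_cert`) with `rX + rZ < n` give
`[[n, n − rX − rZ, dZ]]` for the certificate's code (type-02's census predicate `CSSCode.IsCode`). -/
theorem isCode_of_onesided (hc : commOK c.n c.HX c.HZ = true) (hZ : (c.code hc).dZ = c.dZ)
    (h : c.xzSwapOK sw = true) {cX cZ : RankCert} (hX : cX.check c.n c.HX = true) (hZr : cZ.check c.n c.HZ = true)
    (hk : cX.r + cZ.r < c.n) : (c.code hc).IsCode c.n (c.n - cX.r - cZ.r) c.dZ := by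
  have hkc := c.k_code hc hX hZr
  have hpos : 0 < (c.code hc).k := by rw [hkc]; omega
  have hX' : (c.code hc).dX = c.dZ := by rw [c.dX_eq_dZ_of_xzSwapOK hc h, hZ]
  have := (c.code hc).isCode_of_dX_dZ hpos hX' hZ
  rwa [Fintype.card_fin, hkc, min_self] at this

/-- **One-sided row closer, lane-agnostic form**: the structural check (`checkStructure`: commutation, both upper
witnesses, allow-lists), a FLAT `Z` lower bound `c.dZ − 1 < |w|` on every non-trivial `Z`-logical of the certificate's
matrices — the conclusion shape of every lane's lower-bound theorem (`bz_lower_sound`, `bzAut_lower_sound[_sem|_mitm]`,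
type-12's `bzAut_perm_lower[_sem]`, `infoSet_lower_sound`, kernel-B `le_dZ_of_leaves`) —, the swap check and the two
rank certificates give `[[n, n − rX − rZ, dZ]]`. -/
theorem isCode_of_onesided_lower (hs : c.checkStructure = true)
    (hlow : ∀ w : Fin c.n → ZMod 2, rowMatrix c.n c.HX *ᵥ w = 0 → w ∉ rowSpace (rowMatrix c.n c.HZ) →
      c.dZ - 1 < hammingNorm w)
    (h : c.xzSwapOK sw = true) {cX cZ : RankCert} (hX : cX.check c.n c.HX = true) (hZr : cZ.check c.n c.HZ = true)
    (hk : cX.r + cZ.r < c.n) : (c.code (c.commOK_of_checkStructure hs)).IsCode c.n (c.n - cX.r - cZ.r) c.dZ := by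
  have h' := hs
  simp only [checkStructure, Bool.and_eq_true] at h'
  obtain ⟨hv, hv', hwt⟩ := upper_sound h'.1.1.1.2
  have hZ : (c.code (c.commOK_of_checkStructure hs)).dZ = c.dZ :=
    (c.code _).dZ_eq_of_witness hv hv' hwt fun w hw hw' => by have := hlow w hw hw'; omega
  exact c.isCode_of_onesided _ hZ h hX hZr hk

end DistCert

/-! ## Controls (tier KERNEL, `decide`) -/

/-- `[[4,2,2]]` (`HX = HZ = [1111]`): the identity permutation exchanges the (equal) row sets. -/
theorem xzSwapOK_certC422 : certC422.xzSwapOK ⟨[0, 1, 2, 3], [0], [0]⟩ = true := by decide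

/-- `d_X = d_Z` for `[[4,2,2]]` through the swap check. -/
theorem dX_eq_dZ_certC422 :
    (certC422.code (certC422.commOK_of_check checkDistCert_certC422)).dX =
      (certC422.code (certC422.commOK_of_check checkDistCert_certC422)).dZ :=
  certC422.dX_eq_dZ_of_xzSwapOK _ xzSwapOK_certC422

/-- Steane (`HX = HZ` = the Hamming `[7,4]` checks `[85, 102, 120]`): the identity permutation exchanges the row
sets. -/
theorem xzSwapOK_certSteane7 : certSteane7.xzSwapOK ⟨[0, 1, 2, 3, 4, 5, 6], [0, 1, 2], [0, 1, 2]⟩ = true := by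
  decide

/-- **End-to-end one-sided control**: Steane is `[[7,1,3]]` from the `Z` side of its brute-force certificate
(`dZ_certSteane7`, type-10 p462455), the identity swap, and the rank certificates `rcSteane` (pivots `0,1,2`). -/
theorem isCode_certSteane7_onesided :
    (certSteane7.code (certSteane7.commOK_of_check checkDistCert_certSteane7)).IsCode 7 1 3 :=
  certSteane7.isCode_of_onesided _ dZ_certSteane7 xzSwapOK_certSteane7 (cX := rcSteane) (cZ := rcSteane)
    (by decide) (by decide) (by decide)

/-- Shor `[[9,1,3]]` has `d_X = d_Z = 3` but is NOT `X ↔ Z` symmetric (two `X`-checks of weight `6`, six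
`Z`-checks of weight `2`): the identity is rejected (and so would be every permutation — weights are preserved). -/
example : certShor9.xzSwapOK ⟨[0, 1, 2, 3, 4, 5, 6, 7, 8], [0, 0], [0, 0, 0, 0, 0, 0]⟩ = false := by decide

/-- A two-block toy: `H^X = [A|B]`, `H^Z = [Bᵀ|Aᵀ]` over `G = ℤ₃` with `A = circulant (1 + x)`, `B = 1` (`n = 6`,
left block = qubits `0–2`, right block = `3–5`): `H^X` rows `{0,2,3},{0,1,4},{1,2,5}` = `[13, 19, 38]`, `H^Z` rows
`{0,3,4},{1,4,5},{2,3,5}` = `[25, 50, 44]`; the swap `(L,g) ↦ (R,−g)`, `(R,g) ↦ (L,−g)` = `[3, 5, 4, 0, 2, 1]` with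
both row maps `g ↦ −g` = `[0, 2, 1]` checks. -/
example : xzSwapOK 6 [13, 19, 38] [25, 50, 44] ⟨[3, 5, 4, 0, 2, 1], [0, 2, 1], [0, 2, 1]⟩ = true := by decide

end Summit.Ventures.QEC.Census
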